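import Literature.MathematicalPhysics.QuantumFieldTheory.Balaban1983to89.B2Eq268HiggsRegion

/-!
# `Balaban1983to89.B2Eq268DerivBoxLayer` — [Balaban1982Higgs2] Lemma 2.4, proof step **(2.68) «and similarly for the derivative»**
# p. 572 ON THE (Higgs)₂,₃ CARRIER OF RECORD, the boundary-layer column: for a bond `b₀` at depth `≥ ϱLᵏ` inside a cell-product box `□`,
# `Σ_{y∈∂□}Σ_i‖(D_BG_k(□,B)e_{(y,i)})(b₀)‖ ≤ C₃·(Π_μ|S_μ|)·K₀^{d−1}·ϱ^{−d}·ε` — the codimension-one count of the Neumann boundary layer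
# `∂□` times the far field of the differentiated kernels (2.10); it cancels the `ε⁻¹` of the Leibniz boundary term of own D4′
# `B2Eq268DerivHiggsRegion.eq268_deriv_box`

statement-level skeleton of published theorems with citation tags; proofs where landed; nothing here is a claim
about the Yang–Mills mass gap

PDF held: `paper:balaban1982-cmp86-higgs23-ii` (journal page = PDF page + 554), p. 572 [PDF 18] ((2.68) «and similarly for the
derivative», the sentence «Let us define □₁, □₂ as the sums of large blocks contained in Λ₇^{(k−1)′} and distant from the point y less than
2r(Lᵏε), 4r(Lᵏε) respectively, and let us denote □ = Bᵏ(□₂)», text layer p0018 L6–8/L19–20, re-read this session); [Balaban1983Higgs3]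
p. 426 (2.10) and [Balaban1982Higgs1] Prop. 2.1 p. 611 AS LANDED in p35's `B3Ineq210RegularBox` / `B1Ineq225RegularBox`.

CITATION HEADER (lean-in-tree rule).  T. Bałaban, *(Higgs)₂,₃ quantum fields in a finite volume. II. An upper bound*,
Commun. Math. Phys. **86** (1982) 555–594, doi:10.1007/bf01214890 [Balaban1982Higgs2]; inputs of part I, Commun. Math. Phys. **85**
(1982) 603–626 [Balaban1982Higgs1] and part III, Commun. Math. Phys. **88** (1983) 411–445 [Balaban1983Higgs3] AS LANDED in the tree.
Cell `lit-balaban` (HOME `run/shared/lean/pub/lit-balaban/`), reader/typer seat **r14** gen 21 (B2 second reader; unit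
`lit-balaban-r14-g21`; free-target protocol G.5-34(d): the derivative lane of row B2.Lem2.4 — owner r02 WELCOME 2026-08-23T07:13Z,
p23 «no priority claimed» 07:20Z; TAKING line HOME/STATUS.md for this stem); SKELETON row **B2.Lem2.4** (Lemma 2.4 (2.65)–(2.66)
p. 572; fold owner r02, second reader r14; decl of record `B2.Lemma24Printed`, head `proved p250408 · …` UNCHANGED — cells-only member;
brick D4b′ of the located-residue item «the derivative clause (2.66)/(2.77)», the complement of D4′ `B2Eq268DerivHiggsRegion` HONEST SCOPE
(c)).  Cross-references: rows **B3.Eq2.10** (p35's `B3Ineq210RegularBox.ineq210_regularBox_explicit_small`, derivative clause, with r14's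
pieces `B3Ineq210RegularRegion.{pieceR, sum_pieceR}`), **B1.Prop2.1** (p35's `B1Ineq225RegularBox.{cellBox, cellOf, mem_cellBox}`,
`B1TorusCubeCover.{half, half_pos, half_dvd}`).  USED BY NAME, never restated: the above, r14's `B1Eq230FluctCov.{Ix, cb}`,
`B3Ineq210RegularTorus.{mesh_eq_pow_mul, covDeriv_sum''}`, `B1Ineq234LevelZero.{tdist_shift_le_one, tdist_unshift_le_one, tdist_triangle_real}`,
Mathlib's `Real.pow_div_factorial_le_exp`, `Fintype.piFinset`/`card_piFinset`.  p23's F4′ `B2Eq268HiggsRegion` is imported for the closure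
only (none of its theorems is used: the layer needs the per-piece ENTRIES of (2.10), not F4′'s summed rows `row_sums_box`); nothing of own D4′
`B2Eq268DerivHiggsRegion` is re-proved (D4′ and D4b′ are independent files, combined by the assembly).

WHAT IS PRINTED (p. 572 [PDF 18]).  *«… = (a_kG_k(□, A₀)Q_k^*(A₀)□₁φ)(x) + O((Lᵏε)^{κ₀}), κ₀ > 0, (2.68) and similarly for the derivative.»*,
for `x ∈ Bᵏ(y)` ((2.67)) with *«□₁, □₂ … the sums of large blocks contained in Λ₇^{(k−1)′} and distant from the point y less than 2r(Lᵏε),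
4r(Lᵏε) respectively, … □ = Bᵏ(□₂)»* — so the bonds `b ⊂ Bᵏ(y)` of (2.66)/(2.77) are `≈ 4r(Lᵏε)` (in `Lᵏε`-units) away from `∂□`; [B3] p. 426:
*«|G^η_{(j)}(Ω, B̃; x, x′)| ≤ O(1)(Lʲη)^{−d+2}e^{−δ₁(Lʲη)^{−1}|x−x′|}, (2.10) and if the propagator is differentiated, then for each differentiation,
there is an additional factor (Lʲη)^{−1}»*; [B1] p. 611 l.1–2: the inequalities of Prop. 2.1 hold without restriction on the points for
«rectangular parallelepipeds».

THE ARGUMENT (not displayed in print — «similarly»; the bookkeeping that makes D4′'s boundary term harmless).  D4′ bounds the derivative of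
the `V_k`-remainder of (2.68) with the `D^{ε*}M` sources in Leibniz form; the divergence of the cut field `A′1_{b⊂□}` across the Neumann
boundary of `□` leaves `ε⁻¹|e|sdW₀·Σ_{y∈∂□}κ′(y)`, `κ′(y) = Σ_i‖(D_BG_k(□,B)e_{(y,i)})(b₀)‖`, `∂□ = {y ∈ □ : ∃ν, y ± εe_ν ∉ □}`.  (i) COUNT:
`□ = cellBox S = {x : ⌊x_μ/M⌋ ∈ S_μ ∀μ}`, `M = LᵏK₀`; if `y ∈ □` and `y + εe_ν ∉ □` (resp. `y − εe_ν ∉ □`) then `y_ν mod M = M − 1` (resp. `0`)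
(`M ∣ |T_ε|_ν`), so the `ν`-th family of `∂□` lies in the product set `Π_{μ≠ν}{v : ⌊v/M⌋ ∈ S_μ} × {v : ⌊v/M⌋ ∈ S_ν, v mod M ∈ {M−1, 0}}` of
cardinality `≤ Π_{μ≠ν}(|S_μ|M)·2|S_ν|`; hence `#∂□ ≤ 2d(Π_μ|S_μ|)M^{d−1}` — codimension one.  (ii) FAR FIELD: by (2.10) for the pieces
(derivative clause, p35, every pair of points of the box), `κ′_j(y) ≤ Cst·εᵈ(Lʲε)^{1−d}e^{−δ₁|b₀₋−y|/Lʲ} = Cst·Lʲε·L^{−jd}e^{−δ₁|b₀₋−y|/Lʲ}`, and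
`|b₀₋ − y| ≥ ϱLᵏ` on `∂□`.  (iii) SCALES: `#∂□·Cst·Lʲε·L^{−jd}·e^{−δ₁ϱL^{k−j}} = 2d(Π|S|)K₀^{d−1}Cst·ε·u^{d−1}e^{−δ₁ϱu}`, `u = L^{k−j}`, and
`u^{d−1}e^{−δ₁ϱu} ≤ d!(δ₁ϱ)^{−d}u⁻¹` (`eˣ ≥ xᵈ/d!`), `Σ_{j<k}L^{j−k} ≤ 1` (`L ≥ 2`): summing `G_k = Σ_{j<k}G^η_{(j)}` (r14's `sum_pieceR`),
`Σ_{y∈∂□}κ′(y) ≤ 2d·d!·Cst·δ₁^{−d}·(Π|S|)K₀^{d−1}ϱ^{−d}·ε`.  With D4′: the boundary term is `≤ |e|sdW₀·C₃(Π|S|)K₀^{d−1}ϱ^{−d}` — for print's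
`□` (`|S_μ| ≈ 8r(Lᵏε)/K₀ + O(1)` cells, `ϱ ≈ 4r(Lᵏε) − 1`) the product `(Π|S|)K₀^{d−1}ϱ^{−d}` is bounded uniformly in `ε, k, r`, so the
boundary term is a bounded multiple of the field-switch term `|e|sW₀` (the assembly's reading, D5).

WHAT THIS FILE PROVES (kernel-checked, zero `sorry`; theorems only — NO definition, NO `Prop`-valued fact; axioms standard).
 §1 private arithmetic of one step in `ℤ/nℤ` inside a cell (`val_add_one_of_mod_ne`, `val_sub_one_of_mod_ne`, `div_add_one_eq_of_mod_ne`,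
    `div_sub_one_eq_of_mod_ne`), coordinates of shifted sites, **`layer_on_faces`** (the layer lies on the cell faces), the private counts
    `card_filter_div_mem_le` (`≤ |S|M`), `card_filter_div_mem_face_le` (`≤ 2|S|`), **`card_layer_le`** (`#∂□ ≤ 2d(Π_μ|S_μ|)M^{d−1}`),
    `depth_le_tdist_of_mem_layer` (a ball of radius `R` about `x` inside `Ω` ⇒ `|x − y| ≥ R` on `∂Ω`; r14's `tdist_shift_le_one`, triangle).
 §2 private scale lemmas (`rpow_one_sub`, `scale_identity`, `pow_mul_exp_neg_le`, `sum_half_pow_succ`, `sum_inv_pow_le_one`) and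
    **`layer_column_le`**: `Σ_{y∈∂□}Σ_i‖(D_BG_k(□,B)e_{(y,i)})(b₀)‖ ≤ C₃(Π_μ|S_μ|)K₀^{d−1}ϱ^{−d}ε` in F4′'s `row_sums_box` quantifier format
    (`∃ K₀min, ∀ K₀ ≥ K₀min, ∃ t C₃, …`, same torus/level/box/regularity hypotheses, `+ b₀ ⊂ □`, `+ ϱ > 0` with `ϱLᵏ ≤ |b₀₋ − y|` on `∂□`).

HONEST SCOPE / DIFFERENCES FROM PRINT (recorded, not hidden).  (a) Print does not display this step («similarly for the derivative»); the
file supplies the bookkeeping of the carrier's own Leibniz route (D4′ HONEST SCOPE (c)), not a transcription.  (b) Hypotheses as p35's (2.10)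
on boxes: `□` a cell-product box of big blocks, `K₀ ∣ M`, `3LᵏK₀ ≤ |T_ε|_μ`, `Lᵏε ≤ 1`, `1 ≤ k ≤ K`, `K₀ ≥ K₀min` (raised to `≥ 1`), `B`
(I.2.23)-regular on `□` with `Lᵏδ_B|e| ≤ t`.  (c) The depth `ϱ` is a free real `> 0` in units of `Lᵏ` lattice steps of `T_ε` (print: `b ⊂ Bᵏ(y)`,
`dist(Bᵏ(y), ∂□) ≈ 4r(Lᵏε)·Lᵏ` steps); reading `ϱ`, `|S_μ|` from print's radii is the assembly's (D5).  (d) The constant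
`C₃ = 2d·d!·Cst·δ₁^{−d}` is explicit in p35's `Cst, δ₁` but not numerical.  (e) DEDUP DISCLOSURE: the four private coordinate lemmas
`shift_apply_self/ne`, `unshift_apply_self/ne` duplicate PUBLIC statements of `B10StarCount` (:154–:161, another paper's lane, which imports
`TorusGeometry` + `B10SectAGathering`); private copies are kept here rather than pulling that closure into the B2 lane (hygiene later is fine);
`rpow_one_sub` is F4′'s private lemma re-proved; the six private arithmetic/count helpers of §1 are [folklore].  Value = the boundary-layer column of D4′ is `O(ε)` with the
codimension-one count made explicit; NOT summit progress.
-/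

open scoped BigOperators

noncomputable section

namespace Literature.MathematicalPhysics.QuantumFieldTheory.Balaban1983to89.B2Eq268DerivBoxLayer

open HiggsLattice (ChargeData covDeriv)
open HiggsCovariance (propagatorK E)
open HiggsCovariancePos (Inside shift_unshift unshift_shift)
open B1Ineq225RegularBox (cellBox mem_cellBox cellOf)
open B1TorusCubeCover (half half_pos half_dvd)
open B1Eq230FluctCov (Ix cb)

variable {P : HiggsLattice.Params} {N : ℕ}

/-! ## §1 The boundary layer of a cell-product box has codimension one -/

section Layer

/-- one step up inside a cell: if `v mod h ≠ h − 1` (`h ∣ n`), then `(v + 1).val = v.val + 1` in `ℤ/nℤ`. [folklore] -/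
private theorem val_add_one_of_mod_ne {n h : ℕ} [NeZero n] (hh : h ∣ n) (v : ZMod n) (hv : v.val % h ≠ h - 1) :
    (v + 1).val = v.val + 1 := by
  have hn : 0 < n := Nat.pos_of_ne_zero (NeZero.ne n)
  have hlt : v.val < n := ZMod.val_lt v
  obtain ⟨c, hc⟩ := hh
  have hh0 : 0 < h := Nat.pos_of_ne_zero (by rintro rfl; omega)
  have hc0 : 0 < c := Nat.pos_of_ne_zero (by rintro rfl; omega)
  have hn1 : 1 < n := by
    by_contra h1
    have hn1 : n = 1 := by omega
    have hh1 : h = 1 := by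
      have : h ∣ 1 := ⟨c, by omega⟩
      exact Nat.dvd_one.mp this
    apply hv
    rw [hh1, Nat.mod_one]
  have hne : v.val + 1 ≠ n := by
    intro h1
    apply hv
    have e : v.val = h * (c - 1) + (h - 1) := by
      have : h * c = h * (c - 1) + h := by
        cases c with
        | zero => omega
        | succ c' => simp [Nat.mul_succ]
      omega
    rw [e, Nat.mul_add_mod]
    exact Nat.mod_eq_of_lt (by omega)
  rw [ZMod.val_add, ZMod.val_one_eq_one_mod, Nat.mod_eq_of_lt hn1, Nat.mod_eq_of_lt (by omega)]

/-- one step down inside a cell: if `v mod h ≠ 0`, then `(v − 1).val = v.val − 1` and `v.val ≥ 1`. [folklore] -/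
private theorem val_sub_one_of_mod_ne {n h : ℕ} [NeZero n] (v : ZMod n) (hv : v.val % h ≠ 0) :
    (v - 1).val = v.val - 1 ∧ 1 ≤ v.val := by
  have hv1 : 1 ≤ v.val := by
    by_contra h0
    apply hv
    have : v.val = 0 := by omega
    rw [this, Nat.zero_mod]
  have hlt : v.val < n := ZMod.val_lt v
  have hn1 : 1 < n := by omega
  haveI : Fact (1 < n) := ⟨hn1⟩
  refine ⟨?_, hv1⟩
  rw [ZMod.val_sub, ZMod.val_one]
  rw [ZMod.val_one]; exact hv1

/-- the quotient by `h` does not move one step up unless `v mod h = h − 1`. [folklore] -/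
private theorem div_add_one_eq_of_mod_ne {a h : ℕ} (hh : 0 < h) (hv : a % h ≠ h - 1) : (a + 1) / h = a / h := by
  have h1 : a % h + 1 < h := by
    have := Nat.mod_lt a hh
    omega
  conv_lhs => rw [← Nat.div_add_mod a h]
  rw [add_assoc, Nat.add_div_of_dvd_right (Dvd.intro _ rfl), Nat.mul_div_cancel_left _ hh,
    Nat.div_eq_of_lt h1, add_zero]

/-- … nor one step down unless `v mod h = 0`. [folklore] -/
private theorem div_sub_one_eq_of_mod_ne {a h : ℕ} (hh : 0 < h) (hv : a % h ≠ 0) (ha : 1 ≤ a) : (a - 1) / h = a / h := by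
  obtain ⟨b, rfl⟩ : ∃ b, a = b + 1 := ⟨a - 1, by omega⟩
  rw [Nat.add_sub_cancel]
  refine (div_add_one_eq_of_mod_ne hh fun h2 => hv ?_).symm
  have e : b + 1 = h * (b / h + 1) := by
    have := Nat.div_add_mod b h
    rw [h2] at this
    rw [Nat.mul_add, mul_one]
    omega
  rw [e, Nat.mul_mod_right]

variable {k K₀ : ℕ}

/-- the coordinates of a shifted site. [cite: Balaban1982Higgs1, (1.4) p.604] -/
private theorem shift_apply_self (y : HiggsLattice.Site P 0) (ν : Fin P.d) : (y.shift ν) ν = y ν + 1 := by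
  simp [HiggsLattice.Site.shift]

/-- the other coordinates of a shifted site. [cite: Balaban1982Higgs1, (1.4) p.604] -/
private theorem shift_apply_ne (y : HiggsLattice.Site P 0) {ν μ : Fin P.d} (h : μ ≠ ν) : (y.shift ν) μ = y μ := by
  simp [HiggsLattice.Site.shift, h]

/-- the coordinates of a site shifted back. [cite: Balaban1982Higgs1, (1.4) p.604] -/
private theorem unshift_apply_self (y : HiggsLattice.Site P 0) (ν : Fin P.d) : (y.unshift ν) ν = y ν - 1 := by
  simp [HiggsLattice.Site.unshift]

/-- the other coordinates of a site shifted back. [cite: Balaban1982Higgs1, (1.4) p.604] -/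
private theorem unshift_apply_ne (y : HiggsLattice.Site P 0) {ν μ : Fin P.d} (h : μ ≠ ν) : (y.unshift ν) μ = y μ := by
  simp [HiggsLattice.Site.unshift, h]

/-- **THE BOUNDARY LAYER OF A CELL-PRODUCT BOX LIES ON THE CELL FACES**: if `y ∈ □ = cellBox S` and `y + εe_ν ∉ □` or `y − εe_ν ∉ □`, then
the `ν`-th coordinate of `y` is the last or the first site of its cell (`y_ν mod M ∈ {M − 1, 0}`, `M = LᵏK₀`).
[cite: Balaban1982Higgs1, Prop. 2.1 p.611 l.1–2 («rectangular parallelepipeds»)] -/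
theorem layer_on_faces (hk : k ≤ P.K) (hK₀M : K₀ ∣ P.M) (hK₀ : 1 ≤ K₀) (S : Fin P.d → Finset ℕ)
    {y : HiggsLattice.Site P 0} (hy : y ∈ cellBox k K₀ S) {ν : Fin P.d}
    (hout : y.shift ν ∉ cellBox k K₀ S ∨ y.unshift ν ∉ cellBox k K₀ S) :
    (y ν).val % half P k K₀ = half P k K₀ - 1 ∨ (y ν).val % half P k K₀ = 0 := by
  have hh : 0 < half P k K₀ := half_pos hK₀
  have hdv : half P k K₀ ∣ P.sitesPerDir 0 ν := half_dvd hk hK₀M ν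
  rw [mem_cellBox] at hy
  rcases hout with h | h
  · left
    by_contra hne
    apply h
    rw [mem_cellBox]
    intro μ
    by_cases hμ : μ = ν
    · subst hμ
      unfold B1Ineq225RegularBox.cellOf
      rw [shift_apply_self, val_add_one_of_mod_ne hdv _ hne, div_add_one_eq_of_mod_ne hh hne]
      exact hy μ
    · unfold B1Ineq225RegularBox.cellOf
      rw [shift_apply_ne y hμ]
      exact hy μ
  · right
    by_contra hne
    apply h
    rw [mem_cellBox]
    intro μ
    by_cases hμ : μ = ν
    · subst hμ
      unfold B1Ineq225RegularBox.cellOf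
      obtain ⟨h1, h2⟩ := val_sub_one_of_mod_ne (y μ) hne
      rw [unshift_apply_self, h1, div_sub_one_eq_of_mod_ne hh hne h2]
      exact hy μ
    · unfold B1Ineq225RegularBox.cellOf
      rw [unshift_apply_ne y hμ]
      exact hy μ

/-- the sites of `ℤ/nℤ` whose cell index lies in `S` number at most `|S|·M`. [folklore] -/
private theorem card_filter_div_mem_le {n : ℕ} [NeZero n] {h : ℕ} (hh : 0 < h) (S : Finset ℕ) :
    (Finset.univ.filter fun v : ZMod n => v.val / h ∈ S).card ≤ S.card * h := by
  classical
  have hmap : ∀ v ∈ (Finset.univ.filter fun v : ZMod n => v.val / h ∈ S),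
      (fun v : ZMod n => (v.val / h, v.val % h)) v ∈ S ×ˢ Finset.range h := by
    intro v hv
    rw [Finset.mem_filter] at hv
    rw [Finset.mem_product, Finset.mem_range]
    exact ⟨hv.2, Nat.mod_lt _ hh⟩
  have hinj : Set.InjOn (fun v : ZMod n => (v.val / h, v.val % h))
      ↑(Finset.univ.filter fun v : ZMod n => v.val / h ∈ S) := by
    intro v _ w _ hvw
    simp only [Prod.mk.injEq] at hvw
    apply ZMod.val_injective n
    rw [← Nat.div_add_mod v.val h, ← Nat.div_add_mod w.val h, hvw.1, hvw.2]
  refine (Finset.card_le_card_of_injOn _ hmap hinj).trans ?_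
  rw [Finset.card_product, Finset.card_range]

/-- … and those on the two faces of their cell at most `2|S|`. [folklore] -/
private theorem card_filter_div_mem_face_le {n : ℕ} [NeZero n] (h : ℕ) (S : Finset ℕ) :
    (Finset.univ.filter fun v : ZMod n => v.val / h ∈ S ∧ (v.val % h = h - 1 ∨ v.val % h = 0)).card ≤ S.card * 2 := by
  classical
  have hmap : ∀ v ∈ (Finset.univ.filter fun v : ZMod n => v.val / h ∈ S ∧ (v.val % h = h - 1 ∨ v.val % h = 0)),
      (fun v : ZMod n => (v.val / h, v.val % h)) v ∈ S ×ˢ ({h - 1, 0} : Finset ℕ) := by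
    intro v hv
    rw [Finset.mem_filter] at hv
    rw [Finset.mem_product, Finset.mem_insert, Finset.mem_singleton]
    exact ⟨hv.2.1, hv.2.2⟩
  have hinj : Set.InjOn (fun v : ZMod n => (v.val / h, v.val % h))
      ↑(Finset.univ.filter fun v : ZMod n => v.val / h ∈ S ∧ (v.val % h = h - 1 ∨ v.val % h = 0)) := by
    intro v _ w _ hvw
    simp only [Prod.mk.injEq] at hvw
    apply ZMod.val_injective n
    rw [← Nat.div_add_mod v.val h, ← Nat.div_add_mod w.val h, hvw.1, hvw.2]
  refine (Finset.card_le_card_of_injOn _ hmap hinj).trans ?_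
  rw [Finset.card_product]
  exact Nat.mul_le_mul_left _ ((Finset.card_insert_le _ _).trans (by rw [Finset.card_singleton]))

/-- **THE BOUNDARY LAYER HAS CODIMENSION ONE**: `#∂□ ≤ 2d·(Π_μ|S_μ|)·M^{d−1}` for `□ = cellBox S`, `M = LᵏK₀`
(`∂□ = {y ∈ □ : ∃ν, y ± εe_ν ∉ □}`; each `ν`-face family is a product set with one thin factor).
[cite: Balaban1982Higgs1, Prop. 2.1 p.611 l.1–2] -/
theorem card_layer_le (hk : k ≤ P.K) (hK₀M : K₀ ∣ P.M) (hK₀ : 1 ≤ K₀) (S : Fin P.d → Finset ℕ) :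
    ((cellBox k K₀ S).filter
        (fun y => ∃ ν : Fin P.d, y.shift ν ∉ cellBox k K₀ S ∨ y.unshift ν ∉ cellBox k K₀ S)).card
      ≤ 2 * P.d * (∏ μ : Fin P.d, (S μ).card) * half P k K₀ ^ (P.d - 1) := by
  classical
  have hh : 0 < half P k K₀ := half_pos hK₀
  set M := half P k K₀ with hM
  -- the ν-face families as product sets
  set T : Fin P.d → (μ : Fin P.d) → Finset (ZMod (P.sitesPerDir 0 μ)) := fun ν μ =>
    Finset.univ.filter fun v : ZMod (P.sitesPerDir 0 μ) =>
      v.val / M ∈ S μ ∧ (μ = ν → (v.val % M = M - 1 ∨ v.val % M = 0)) with hT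
  have hsub : ((cellBox k K₀ S).filter
        (fun y => ∃ ν : Fin P.d, y.shift ν ∉ cellBox k K₀ S ∨ y.unshift ν ∉ cellBox k K₀ S))
      ⊆ Finset.univ.biUnion fun ν => Fintype.piFinset (T ν) := by
    intro y hy
    rw [Finset.mem_filter] at hy
    obtain ⟨hyΩ, ν, hν⟩ := hy
    rw [Finset.mem_biUnion]
    refine ⟨ν, Finset.mem_univ _, Fintype.mem_piFinset.2 fun μ => ?_⟩
    rw [hT, Finset.mem_filter]
    refine ⟨Finset.mem_univ _, (mem_cellBox.1 hyΩ) μ, ?_⟩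
    rintro rfl
    exact layer_on_faces hk hK₀M hK₀ S hyΩ hν
  have hcardT : ∀ ν μ, (T ν μ).card ≤ (S μ).card * Function.update (fun _ : Fin P.d => M) ν 2 μ := by
    intro ν μ
    by_cases hμ : μ = ν
    · subst hμ
      rw [Function.update_self]
      refine le_trans (Finset.card_le_card ?_) (card_filter_div_mem_face_le (n := P.sitesPerDir 0 μ) M (S μ))
      intro v hv
      rw [hT, Finset.mem_filter] at hv
      rw [Finset.mem_filter]
      exact ⟨hv.1, hv.2.1, hv.2.2 rfl⟩
    · rw [Function.update_of_ne hμ]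
      refine le_trans (Finset.card_le_card ?_) (card_filter_div_mem_le (n := P.sitesPerDir 0 μ) hh (S μ))
      intro v hv
      rw [hT, Finset.mem_filter] at hv
      rw [Finset.mem_filter]
      exact ⟨hv.1, hv.2.1⟩
  have hpi : ∀ ν : Fin P.d, (Fintype.piFinset (T ν)).card ≤ 2 * (∏ μ : Fin P.d, (S μ).card) * M ^ (P.d - 1) := by
    intro ν
    rw [Fintype.card_piFinset]
    calc ∏ μ, (T ν μ).card ≤ ∏ μ, (S μ).card * Function.update (fun _ : Fin P.d => M) ν 2 μ :=
          Finset.prod_le_prod (fun μ _ => Nat.zero_le _) fun μ _ => hcardT ν μ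
      _ = (∏ μ, (S μ).card) * ∏ μ, Function.update (fun _ : Fin P.d => M) ν 2 μ := Finset.prod_mul_distrib
      _ = (∏ μ, (S μ).card) * (2 * M ^ (P.d - 1)) := by
          congr 1
          rw [Finset.prod_update_of_mem (Finset.mem_univ ν), Finset.prod_const]
          congr 2
          rw [Finset.card_univ_sdiff, Finset.card_singleton, Fintype.card_fin]
      _ = 2 * (∏ μ : Fin P.d, (S μ).card) * M ^ (P.d - 1) := by ring
  calc ((cellBox k K₀ S).filter
          (fun y => ∃ ν : Fin P.d, y.shift ν ∉ cellBox k K₀ S ∨ y.unshift ν ∉ cellBox k K₀ S)).card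
      ≤ (Finset.univ.biUnion fun ν => Fintype.piFinset (T ν)).card := Finset.card_le_card hsub
    _ ≤ ∑ ν : Fin P.d, (Fintype.piFinset (T ν)).card := Finset.card_biUnion_le
    _ ≤ ∑ _ν : Fin P.d, 2 * (∏ μ : Fin P.d, (S μ).card) * M ^ (P.d - 1) := Finset.sum_le_sum fun ν _ => hpi ν
    _ = 2 * P.d * (∏ μ : Fin P.d, (S μ).card) * M ^ (P.d - 1) := by
        rw [Finset.sum_const, Finset.card_univ, Fintype.card_fin, smul_eq_mul]; ring

/-- **DEPTH ⇒ DISTANCE TO THE LAYER**: if the ball `{z : |x − z| ≤ R}` lies in `Ω`, every site of the boundary layer `∂Ω` is at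
distance `≥ R` from `x` (a layer site has a neighbour outside `Ω`, one step away). [cite: Balaban1982Higgs2, Lemma 2.4 proof p.572 («□₁, □₂ …
distant from the point y less than 2r(Lᵏε), 4r(Lᵏε)»)] -/
theorem depth_le_tdist_of_mem_layer (Ω : Finset (HiggsLattice.Site P 0)) {x : HiggsLattice.Site P 0} {R : ℕ}
    (hdepth : ∀ z, HiggsLattice.Site.tdist x z ≤ R → z ∈ Ω) {y : HiggsLattice.Site P 0}
    (hy : y ∈ Ω.filter (fun y => ∃ ν : Fin P.d, y.shift ν ∉ Ω ∨ y.unshift ν ∉ Ω)) :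
    R ≤ HiggsLattice.Site.tdist x y := by
  rw [Finset.mem_filter] at hy
  obtain ⟨_, ν, hν⟩ := hy
  -- the neighbour `y′` of `y` outside `Ω` is at distance `> R` from `x` and `≤ 1` from `y`
  have key : ∀ y' : HiggsLattice.Site P 0, y' ∉ Ω → HiggsLattice.Site.tdist y y' ≤ 1 → R ≤ HiggsLattice.Site.tdist x y := by
    intro y' hy' h1
    have hR : R < HiggsLattice.Site.tdist x y' := by
      by_contra h
      exact hy' (hdepth y' (not_lt.1 h))
    have htri := B1Ineq234LevelZero.tdist_triangle_real x y y'
    have h1' : (HiggsLattice.Site.tdist y y' : ℝ) ≤ 1 := by exact_mod_cast h1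
    have hR' : (R : ℝ) + 1 ≤ (HiggsLattice.Site.tdist x y' : ℝ) := by exact_mod_cast hR
    have : (R : ℝ) ≤ (HiggsLattice.Site.tdist x y : ℝ) := by linarith
    exact_mod_cast this
  rcases hν with h | h
  · exact key _ h (B1Ineq234LevelZero.tdist_shift_le_one y ν)
  · exact key _ h (B1Ineq234LevelZero.tdist_unshift_le_one y ν)

end Layer

/-! ## §2 The boundary-layer column of `D_BG_k(□, B)` at a deep bond -/

section Column

open B3Ineq210RegularRegion (pieceR sum_pieceR)
open B3Ineq210RegularBox (ineq210_regularBox_explicit_small)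
open B3Ineq210RegularTorus (mesh_eq_pow_mul covDeriv_sum'')

/-- `(Lʲε)^{1−d} = (Lʲε)·((Lʲε)ᵈ)⁻¹` (F4′'s private lemma, re-proved). [folklore] -/
private theorem rpow_one_sub (j : ℕ) : P.mesh j ^ ((1 : ℝ) - (P.d : ℝ)) = P.mesh j * (P.mesh j ^ P.d)⁻¹ := by
  rw [Real.rpow_sub (P.mesh_pos j), div_eq_mul_inv, Real.rpow_natCast _ P.d, Real.rpow_one]

/-- `εᵈ·(Lʲε)·((Lʲε)ᵈ)⁻¹·(LᵏK₀)^{d−1} = ε·K₀^{d−1}·(L^{k−j})^{d−1}` for `j ≤ k`, `d ≥ 1`. [cite: Balaban1982Higgs1, (1.19) p.607] -/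
private theorem scale_identity {k j : ℕ} (hjk : j ≤ k) (hd : 1 ≤ P.d) (K₀ : ℕ) :
    P.mesh 0 ^ P.d * (P.mesh j * (P.mesh j ^ P.d)⁻¹) * ((half P k K₀ : ℕ) : ℝ) ^ (P.d - 1)
      = P.mesh 0 * (K₀ : ℝ) ^ (P.d - 1) * (((P.L : ℝ) ^ (k - j)) ^ (P.d - 1)) := by
  have hε : P.mesh 0 ≠ 0 := (P.mesh_pos 0).ne'
  have hL : (P.L : ℝ) ≠ 0 := (Nat.cast_pos.mpr P.hL).ne'
  obtain ⟨e, he⟩ : ∃ e, P.d = e + 1 := ⟨P.d - 1, by omega⟩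
  obtain ⟨m, rfl⟩ : ∃ m, k = j + m := ⟨k - j, by omega⟩
  rw [he, Nat.add_sub_cancel, Nat.add_sub_cancel_left, mesh_eq_pow_mul P j]
  unfold B1TorusCubeCover.half
  push_cast
  rw [pow_add (P.L : ℝ) j m]
  field_simp
  ring

/-- `u^{d−1}e^{−cu} ≤ d!·c^{−d}·u⁻¹` for `u, c > 0` (`e^{cu} ≥ (cu)ᵈ/d!`). [folklore] -/
private theorem pow_mul_exp_neg_le {d : ℕ} (hd : 1 ≤ d) {c u : ℝ} (hc : 0 < c) (hu : 0 < u) :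
    u ^ (d - 1) * Real.exp (-(c * u)) ≤ (d.factorial : ℝ) * (c ^ d)⁻¹ * u⁻¹ := by
  have hcu : 0 < c * u := mul_pos hc hu
  have h := Real.pow_div_factorial_le_exp (c * u) hcu.le d
  have hfact : (0 : ℝ) < d.factorial := by exact_mod_cast Nat.factorial_pos d
  rw [div_le_iff₀ hfact] at h
  -- `(cu)^d ≤ e^{cu} d!` ⇒ `u^{d-1} e^{-cu} ≤ d! c^{-d} u^{-1}`
  obtain ⟨e, rfl⟩ : ∃ e, d = e + 1 := ⟨d - 1, by omega⟩
  rw [Nat.add_sub_cancel]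
  rw [Real.exp_neg]
  have hexp : 0 < Real.exp (c * u) := Real.exp_pos _
  rw [mul_inv_le_iff₀ hexp]
  have e1 : ((e + 1).factorial : ℝ) * (c ^ (e + 1))⁻¹ * u⁻¹ * Real.exp (c * u)
      = (Real.exp (c * u) * (e + 1).factorial) / (c ^ (e + 1) * u) := by
    field_simp
  rw [e1, le_div_iff₀ (by positivity)]
  calc u ^ e * (c ^ (e + 1) * u) = (c * u) ^ (e + 1) := by ring
    _ ≤ Real.exp (c * u) * (e + 1).factorial := h

/-- `Σ_{n<k} 2^{−(n+1)} = 1 − 2^{−k}`. [folklore] -/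
private theorem sum_half_pow_succ (k : ℕ) : ∑ n ∈ Finset.range k, (1 / 2 : ℝ) ^ (n + 1) = 1 - (1 / 2 : ℝ) ^ k := by
  induction k with
  | zero => simp
  | succ n ih => rw [Finset.sum_range_succ, ih]; ring

/-- `Σ_{j<k} (L^{k−j})⁻¹ ≤ 1` for `L ≥ 2`. [folklore] -/
private theorem sum_inv_pow_le_one {r : ℝ} (hr : 2 ≤ r) (k : ℕ) :
    ∑ j ∈ Finset.range k, ((r ^ (k - j))⁻¹ : ℝ) ≤ 1 := by
  have hterm : ∀ j ∈ Finset.range k, ((r ^ (k - j))⁻¹ : ℝ) ≤ (1 / 2 : ℝ) ^ (k - j) := by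
    intro j _
    rw [one_div, inv_pow]
    exact inv_anti₀ (pow_pos (by norm_num) _) (pow_le_pow_left₀ (by norm_num) hr _)
  refine (Finset.sum_le_sum hterm).trans ?_
  have hre : ∑ j ∈ Finset.range k, (1 / 2 : ℝ) ^ (k - j) = ∑ n ∈ Finset.range k, (1 / 2 : ℝ) ^ (n + 1) := by
    rw [← Finset.sum_range_reflect]
    refine Finset.sum_congr rfl fun n hn => ?_
    have := Finset.mem_range.1 hn
    congr 1
    omega
  rw [hre, sum_half_pow_succ]
  have : (0 : ℝ) ≤ (1 / 2 : ℝ) ^ k := by positivity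
  linarith

/-- **THE BOUNDARY-LAYER COLUMN OF `D_BG_k(□,B)` AT A DEEP BOND** (ε-lattice currency).  For `d ≥ 1`, `L ≥ 2`, `a, m² > 0`, `N`, charge
data: there are `K₀min` and, per `K₀ ≥ K₀min`, a threshold `t > 0` and a constant `C₃ ≥ 0` such that on every torus of the carrier with `K₀ ∣ M`,
at every level `1 ≤ k ≤ K_P` with `3LᵏK₀ ≤ |T_ε|_μ`, `Lᵏε ≤ 1`, for every cell-product box `□ = cellBox S`, every (I.2.23)-regular `B` on `□` with
`Lᵏδ_B|e| ≤ t`, every bond `b₀ ⊂ □` and every `ϱ > 0` with `ϱ·Lᵏ ≤ |b₀₋ − y|` for all `y` in the boundary layer `∂□ = {y ∈ □ : ∃ν, y ± εe_ν ∉ □}`: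
`Σ_{y∈∂□}Σ_i‖(D_BG_k(□,B)e_{(y,i)})(b₀)‖ ≤ C₃·(Π_μ|S_μ|)·K₀^{d−1}·ϱ^{−d}·ε` — the derivative clause of (2.10) for the pieces `G^η_{(j)}`
(«additional factor (Lʲη)^{−1}») at distance `≥ ϱLᵏ`, times the codimension-one count `#∂□ ≤ 2d(Π|S|)(LᵏK₀)^{d−1}`, summed over the scales with
`u^{d−1}e^{−δ₁ϱu} ≤ d!(δ₁ϱ)^{−d}u⁻¹`, `Σ_{j<k}L^{j−k} ≤ 1`; `C₃ = 2d·d!·Cst·δ₁^{−d}`.  (The factor `ε` cancels the `ε⁻¹` of the Leibniz boundary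
term of `B2Eq268DerivHiggsRegion.eq268_deriv_box`.)
[cite: Balaban1983Higgs3, (2.10) p.426] [cite: Balaban1982Higgs1, Prop. 2.1 p.611] [cite: Balaban1982Higgs2, Lemma 2.4 proof (2.68) p.572] -/
theorem layer_column_le (d L : ℕ) (hd : 1 ≤ d) (hL : 2 ≤ L) {a : ℝ} (ha : 0 < a) {msq : ℝ} (hmsq : 0 < msq)
    (N : ℕ) (C : ChargeData N) :
    ∃ K₀min : ℕ, ∀ K₀ : ℕ, K₀min ≤ K₀ → ∃ t C₃ : ℝ, 0 < t ∧ 0 ≤ C₃ ∧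
      ∀ (P : HiggsLattice.Params), P.d = d → P.L = L → K₀ ∣ P.M →
      ∀ {k : ℕ}, 1 ≤ k → k ≤ P.K → (∀ μ, 3 * half P k K₀ ≤ P.sitesPerDir 0 μ) → P.mesh k ≤ 1 →
      ∀ (S : Fin P.d → Finset ℕ) (B : HiggsLattice.VecField P 0) {δB : ℝ}, 0 ≤ δB →
        (∀ z ∈ cellBox k K₀ S, ∀ μ ν : Fin P.d, |B ⟨z.shift ν, μ⟩ - B ⟨z, μ⟩| ≤ δB) →
        (P.L : ℝ) ^ k * δB * |C.e| ≤ t →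
      ∀ (b₀ : HiggsLattice.PBond P 0), Inside (cellBox k K₀ S) b₀ →
      ∀ {ϱ : ℝ}, 0 < ϱ →
        (∀ y ∈ (cellBox k K₀ S).filter
            (fun y => ∃ ν : Fin P.d, y.shift ν ∉ cellBox k K₀ S ∨ y.unshift ν ∉ cellBox k K₀ S),
          ϱ * (P.L : ℝ) ^ k ≤ (HiggsLattice.Site.tdist b₀.src y : ℝ)) →
        ∑ y ∈ (cellBox k K₀ S).filter
            (fun y => ∃ ν : Fin P.d, y.shift ν ∉ cellBox k K₀ S ∨ y.unshift ν ∉ cellBox k K₀ S),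
          ∑ i : Ix N, ‖covDeriv C B (propagatorK C (cellBox k K₀ S) B msq a k (cb P N 0 (y, i))) b₀‖
          ≤ C₃ * (∏ μ : Fin P.d, ((S μ).card : ℝ)) * (K₀ : ℝ) ^ (d - 1) * (ϱ ^ d)⁻¹ * P.mesh 0 := by
  obtain ⟨K₀min, h⟩ := ineq210_regularBox_explicit_small d L hd hL ha hmsq N C
  refine ⟨max K₀min 1, fun K₀ hK₀ => ?_⟩
  have hK₀min : K₀min ≤ K₀ := le_trans (le_max_left _ _) hK₀
  have hK₀1 : 1 ≤ K₀ := le_trans (le_max_right _ _) hK₀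
  obtain ⟨t, δ₁, Cst, ht, hδ₁, hCst, h⟩ := h K₀ hK₀min
  refine ⟨t, 2 * d * d.factorial * Cst * (δ₁ ^ d)⁻¹, ht, by positivity, ?_⟩
  intro P hPd hPL hK₀M k hk1 hkK h3 hmesh S B δB hδB hreg ht' b₀ hb₀ ϱ hϱ hfar
  have hP1 : 1 < P.L := by rw [hPL]; omega
  have hL2 : (2 : ℝ) ≤ P.L := by rw [hPL]; exact_mod_cast hL
  have hpiece := h P hP1 hPd hPL hK₀M hk1 hkK h3 hmesh S B hδB hreg ht'
  subst hPd
  have hdP : 1 ≤ P.d := hd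
  set Ω := cellBox k K₀ S with hΩdef
  set Lay := Ω.filter (fun y => ∃ ν : Fin P.d, y.shift ν ∉ Ω ∨ y.unshift ν ∉ Ω) with hLay
  have hLayΩ : ∀ y ∈ Lay, y ∈ Ω := fun y hy => (Finset.mem_filter.1 hy).1
  have hεpos : 0 < P.mesh 0 := P.mesh_pos 0
  have hεd : 0 < P.mesh 0 ^ P.d := pow_pos hεpos _
  have hLr : (0 : ℝ) < P.L := by exact_mod_cast P.hL
  -- the count of the layer
  have hcard : (Lay.card : ℝ) ≤ 2 * P.d * (∏ μ : Fin P.d, ((S μ).card : ℝ)) * ((half P k K₀ : ℕ) : ℝ) ^ (P.d - 1) := by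
    have h := (Nat.cast_le (α := ℝ)).2 (card_layer_le hkK hK₀M hK₀1 S)
    rw [← hΩdef] at h
    push_cast at h
    exact h
  -- per piece and per layer site: the derivative entry at distance `≥ ϱLᵏ`
  have hentry : ∀ j, j < k → ∀ y ∈ Lay,
      ∑ i : Ix N, ‖covDeriv C B (pieceR C Ω B msq a k j (cb P N 0 (y, i))) b₀‖
        ≤ Cst * (P.mesh 0 ^ P.d * (P.mesh j * (P.mesh j ^ P.d)⁻¹)) * Real.exp (-(δ₁ * ϱ * (P.L : ℝ) ^ (k - j))) := by
    intro j hj y hy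
    have hd' := (hpiece j b₀.src y hb₀.1 (hLayΩ y hy)).2 b₀.dir hb₀.2
    rw [inv_mul_le_iff₀ hεd, rpow_one_sub] at hd'
    refine hd'.trans ?_
    have hc : 0 ≤ P.mesh 0 ^ P.d * (Cst * (P.mesh j * (P.mesh j ^ P.d)⁻¹)) := by
      have := P.mesh_pos j; positivity
    calc P.mesh 0 ^ P.d * (Cst * (P.mesh j * (P.mesh j ^ P.d)⁻¹) *
            Real.exp (-(δ₁ * (P.mesh j)⁻¹ * (P.mesh 0 * (HiggsLattice.Site.tdist b₀.src y : ℝ)))))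
        = P.mesh 0 ^ P.d * (Cst * (P.mesh j * (P.mesh j ^ P.d)⁻¹)) *
            Real.exp (-(δ₁ * (P.mesh j)⁻¹ * (P.mesh 0 * (HiggsLattice.Site.tdist b₀.src y : ℝ)))) := by ring
      _ ≤ P.mesh 0 ^ P.d * (Cst * (P.mesh j * (P.mesh j ^ P.d)⁻¹)) * Real.exp (-(δ₁ * ϱ * (P.L : ℝ) ^ (k - j))) := by
          refine mul_le_mul_of_nonneg_left (Real.exp_le_exp.2 (neg_le_neg ?_)) hc
          -- `δ₁ϱL^{k−j} ≤ δ₁(Lʲε)⁻¹·ε·|b₀₋ − y|` since `ϱLᵏ ≤ |b₀₋ − y|`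
          have hy' := hfar y hy
          have hmj : 0 < P.mesh j := P.mesh_pos j
          rw [mesh_eq_pow_mul P j]
          have hLj : (0 : ℝ) < (P.L : ℝ) ^ j := pow_pos hLr _
          obtain ⟨m, rfl⟩ : ∃ m, k = j + m := ⟨k - j, by omega⟩
          rw [Nat.add_sub_cancel_left]
          rw [pow_add] at hy'
          have e : δ₁ * ((P.L : ℝ) ^ j * P.mesh 0)⁻¹ * (P.mesh 0 * (HiggsLattice.Site.tdist b₀.src y : ℝ))
              = δ₁ * ((HiggsLattice.Site.tdist b₀.src y : ℝ) / (P.L : ℝ) ^ j) := by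
            field_simp
          rw [e, mul_assoc]
          refine mul_le_mul_of_nonneg_left ?_ hδ₁.le
          rw [le_div_iff₀ hLj]
          linarith
      _ = Cst * (P.mesh 0 ^ P.d * (P.mesh j * (P.mesh j ^ P.d)⁻¹)) * Real.exp (-(δ₁ * ϱ * (P.L : ℝ) ^ (k - j))) := by
          ring
  -- per piece: the layer column
  have hLayj : ∀ j, j < k →
      ∑ y ∈ Lay, ∑ i : Ix N, ‖covDeriv C B (pieceR C Ω B msq a k j (cb P N 0 (y, i))) b₀‖
        ≤ 2 * P.d * (∏ μ : Fin P.d, ((S μ).card : ℝ)) * (K₀ : ℝ) ^ (P.d - 1) * Cst * P.mesh 0 *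
            ((((P.L : ℝ) ^ (k - j)) ^ (P.d - 1)) * Real.exp (-(δ₁ * ϱ * (P.L : ℝ) ^ (k - j)))) := by
    intro j hj
    have hq : 0 ≤ Cst * (P.mesh 0 ^ P.d * (P.mesh j * (P.mesh j ^ P.d)⁻¹)) * Real.exp (-(δ₁ * ϱ * (P.L : ℝ) ^ (k - j))) := by
      have := P.mesh_pos j; positivity
    calc ∑ y ∈ Lay, ∑ i : Ix N, ‖covDeriv C B (pieceR C Ω B msq a k j (cb P N 0 (y, i))) b₀‖
        ≤ ∑ _y ∈ Lay, Cst * (P.mesh 0 ^ P.d * (P.mesh j * (P.mesh j ^ P.d)⁻¹)) *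
            Real.exp (-(δ₁ * ϱ * (P.L : ℝ) ^ (k - j))) := Finset.sum_le_sum (hentry j hj)
      _ = Lay.card * (Cst * (P.mesh 0 ^ P.d * (P.mesh j * (P.mesh j ^ P.d)⁻¹)) *
            Real.exp (-(δ₁ * ϱ * (P.L : ℝ) ^ (k - j)))) := by rw [Finset.sum_const, nsmul_eq_mul]
      _ ≤ (2 * P.d * (∏ μ : Fin P.d, ((S μ).card : ℝ)) * ((half P k K₀ : ℕ) : ℝ) ^ (P.d - 1)) *
            (Cst * (P.mesh 0 ^ P.d * (P.mesh j * (P.mesh j ^ P.d)⁻¹)) *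
              Real.exp (-(δ₁ * ϱ * (P.L : ℝ) ^ (k - j)))) := mul_le_mul_of_nonneg_right hcard hq
      _ = 2 * P.d * (∏ μ : Fin P.d, ((S μ).card : ℝ)) * Cst *
            (P.mesh 0 ^ P.d * (P.mesh j * (P.mesh j ^ P.d)⁻¹) * ((half P k K₀ : ℕ) : ℝ) ^ (P.d - 1)) *
              Real.exp (-(δ₁ * ϱ * (P.L : ℝ) ^ (k - j))) := by ring
      _ = 2 * P.d * (∏ μ : Fin P.d, ((S μ).card : ℝ)) * (K₀ : ℝ) ^ (P.d - 1) * Cst * P.mesh 0 *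
            ((((P.L : ℝ) ^ (k - j)) ^ (P.d - 1)) * Real.exp (-(δ₁ * ϱ * (P.L : ℝ) ^ (k - j)))) := by
          rw [scale_identity hj.le hdP K₀]; ring
  -- the scale function `u^{d−1}e^{−δ₁ϱu}` at `u = L^{k−j}`
  have hscale : ∀ j, j < k →
      (((P.L : ℝ) ^ (k - j)) ^ (P.d - 1)) * Real.exp (-(δ₁ * ϱ * (P.L : ℝ) ^ (k - j)))
        ≤ (P.d.factorial : ℝ) * ((δ₁ * ϱ) ^ P.d)⁻¹ * ((P.L : ℝ) ^ (k - j))⁻¹ := by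
    intro j hj
    have hu : (0 : ℝ) < (P.L : ℝ) ^ (k - j) := pow_pos hLr _
    exact pow_mul_exp_neg_le hdP (mul_pos hδ₁ hϱ) hu
  -- assemble over the scales
  have hsum := sum_pieceR (C := C) (Ω := Ω) (A := B) (msq := msq) (a := a) hmsq ha hP1 hk1 hkK
  have hprod : 0 ≤ ∏ μ : Fin P.d, ((S μ).card : ℝ) := Finset.prod_nonneg fun μ _ => Nat.cast_nonneg _
  have hcoef : 0 ≤ 2 * P.d * (∏ μ : Fin P.d, ((S μ).card : ℝ)) * (K₀ : ℝ) ^ (P.d - 1) * Cst * P.mesh 0 :=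
    mul_nonneg (mul_nonneg (mul_nonneg (mul_nonneg (mul_nonneg (by norm_num) (Nat.cast_nonneg _)) hprod)
      (pow_nonneg (Nat.cast_nonneg _) _)) hCst.le) hεpos.le
  have hfac : 0 ≤ (P.d.factorial : ℝ) * ((δ₁ * ϱ) ^ P.d)⁻¹ := by positivity
  calc ∑ y ∈ Lay, ∑ i : Ix N, ‖covDeriv C B (propagatorK C Ω B msq a k (cb P N 0 (y, i))) b₀‖
      ≤ ∑ y ∈ Lay, ∑ i : Ix N, ∑ j ∈ Finset.range k, ‖covDeriv C B (pieceR C Ω B msq a k j (cb P N 0 (y, i))) b₀‖ := by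
        refine Finset.sum_le_sum fun y _ => Finset.sum_le_sum fun i _ => ?_
        rw [← hsum, LinearMap.sum_apply, covDeriv_sum'']
        exact norm_sum_le _ _
    _ = ∑ y ∈ Lay, ∑ j ∈ Finset.range k, ∑ i : Ix N, ‖covDeriv C B (pieceR C Ω B msq a k j (cb P N 0 (y, i))) b₀‖ :=
        Finset.sum_congr rfl fun y _ => Finset.sum_comm
    _ = ∑ j ∈ Finset.range k, ∑ y ∈ Lay, ∑ i : Ix N, ‖covDeriv C B (pieceR C Ω B msq a k j (cb P N 0 (y, i))) b₀‖ :=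
        Finset.sum_comm
    _ ≤ ∑ j ∈ Finset.range k, 2 * P.d * (∏ μ : Fin P.d, ((S μ).card : ℝ)) * (K₀ : ℝ) ^ (P.d - 1) * Cst * P.mesh 0 *
          ((P.d.factorial : ℝ) * ((δ₁ * ϱ) ^ P.d)⁻¹ * ((P.L : ℝ) ^ (k - j))⁻¹) := by
        refine Finset.sum_le_sum fun j hj => ?_
        have hj' := Finset.mem_range.1 hj
        exact (hLayj j hj').trans (mul_le_mul_of_nonneg_left (hscale j hj') hcoef)
    _ = 2 * P.d * (∏ μ : Fin P.d, ((S μ).card : ℝ)) * (K₀ : ℝ) ^ (P.d - 1) * Cst * P.mesh 0 *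
          ((P.d.factorial : ℝ) * ((δ₁ * ϱ) ^ P.d)⁻¹) * ∑ j ∈ Finset.range k, ((P.L : ℝ) ^ (k - j))⁻¹ := by
        rw [Finset.mul_sum]
        refine Finset.sum_congr rfl fun j _ => ?_
        ring
    _ ≤ 2 * P.d * (∏ μ : Fin P.d, ((S μ).card : ℝ)) * (K₀ : ℝ) ^ (P.d - 1) * Cst * P.mesh 0 *
          ((P.d.factorial : ℝ) * ((δ₁ * ϱ) ^ P.d)⁻¹) * 1 :=
        mul_le_mul_of_nonneg_left (sum_inv_pow_le_one hL2 k) (mul_nonneg hcoef hfac)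
    _ = 2 * P.d * P.d.factorial * Cst * (δ₁ ^ P.d)⁻¹ * (∏ μ : Fin P.d, ((S μ).card : ℝ)) * (K₀ : ℝ) ^ (P.d - 1) *
          (ϱ ^ P.d)⁻¹ * P.mesh 0 := by
        rw [mul_pow, mul_inv]
        ring

end Column

end Literature.MathematicalPhysics.QuantumFieldTheory.Balaban1983to89.B2Eq268DerivBoxLayer

end
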